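import Mathlib.Topology.Algebra.OpenSubgroup
import Mathlib.Topology.Bases
import Mathlib.GroupTheory.Coset.Basic
import Mathlib.MeasureTheory.Constructions.BorelSpace.Basic
import HarnessLib

/-!
# F0 · P3c · line LH6 «StCharTS» — ROAD «JAC-LOC» brick (J6b) «OPEN COSET COVER★» (generic core): in a second-countable topological group with a nested neighbourhood basis of open
# subgroups `K₀ ≥ K₁ ≥ …`, every open set is a countable union of pairwise DISJOINT cosets `g • Kₙ` — the `𝒞 ∕ 𝒟` clause of ★-candidate (J1)(b) `tubeJacobianLocal_of_cover`

Cell `pub/hodgecm-mathlib`, crux H413 = `stmt-HodgeConjecture-24833` (lane `--supports … --as helper`); seat F0P3-p02 (g21); ROAD «JAC-LOC» (holder LH6-p03 (g5), memo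
`F0/P3b/LH6-p03/g5/ROAD-JAC-LOC.v2.LH6p03g5.md` §2 (J6) «ASSEMBLY»: «the cosets `s′T_γ′ ⊆ U` form a π-system generating Borel(U)» ∕ (J1)(b) covering form).  THEOREMS ONLY, Mathlib-only
imports; GENERIC (`G` any topological group; the consumer instantiates `G := ↥(cmBorelTriple L 3 v).M`, `K n := T ∩ K_{γₙ}` the torus levels of ★ (J2)).  HONEST LABEL: HC_CM is proved only
modulo the 7 printed citations (2 remaining: hLiu418 = `stmt-HodgeConjecture-24832`, h413 = `stmt-HodgeConjecture-24833`) until rung 0 closes; count-neutral bookkeeping.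
* `smul_coe_eq_of_mem`, `mem_own_smul_coe` — coset bookkeeping; `exists_disjoint_coset_cover` — the maximal-coset decomposition (Lindelöf: disjoint open sets are countable);
* `cosetFamily_measurable_and_cover` — the packaged clause «`∀ C ∈ 𝒞, MeasurableSet C` ∧ every open `O` is `⋃₀ 𝒟`, `𝒟 ⊆ 𝒞` countable pairwise disjoint» for `𝒞 = {g • Kₙ | n ≥ n₀}`.

## References
* [Folland1995] G. B. Folland, *A Course in Abstract Harmonic Analysis* (1995), §2.6 (locally compact totally disconnected groups; cosets of compact open subgroups) — background.
* [HarishChandra1970] Harish-Chandra (notes by G. van Dijk), LNM 162 (1970), Lemma 22 (the tube argument this bookkeeping serves).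
-/

set_option autoImplicit false
set_option linter.dupNamespace false

open Topology Filter Set
open scoped Pointwise

namespace Summit.HodgeConjecture.HodgeConjecture.Cruxes.H413.F0P3cStCharTSOpenCosetCover

variable {G : Type*} [Group G] [TopologicalSpace G] [IsTopologicalGroup G]

omit [TopologicalSpace G] [IsTopologicalGroup G] in
/-- If `z ∈ x • K` then `z • K = x • K` (left cosets of a subgroup). [folklore] -/
theorem smul_coe_eq_of_mem (K : Subgroup G) {x z : G} (hz : z ∈ x • (K : Set G)) : z • (K : Set G) = x • (K : Set G) := by
  rw [mem_leftCoset_iff] at hz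
  ext y
  rw [mem_leftCoset_iff, mem_leftCoset_iff]
  constructor
  · intro hy
    have : x⁻¹ * y = (x⁻¹ * z) * (z⁻¹ * y) := by rw [mul_assoc, mul_inv_cancel_left]
    rw [this]; exact K.mul_mem hz hy
  · intro hy
    have : z⁻¹ * y = (x⁻¹ * z)⁻¹ * (x⁻¹ * y) := by rw [mul_inv_rev, inv_inv, mul_assoc, mul_inv_cancel_left]
    rw [this]; exact K.mul_mem (K.inv_mem hz) hy

omit [TopologicalSpace G] [IsTopologicalGroup G] in
/-- `x ∈ x • K`. [folklore] -/
theorem mem_own_smul_coe (K : Subgroup G) (x : G) : x ∈ x • (K : Set G) := by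
  rw [mem_leftCoset_iff, inv_mul_cancel]; exact K.one_mem

/-- **Disjoint coset decomposition of an open set (locally profinite bookkeeping).**  `K₀ ≥ K₁ ≥ …` open subgroups forming a neighbourhood basis of `1` in a second-countable
topological group `G`: every open `O` is a countable union of pairwise DISJOINT left cosets `g • Kₙ ⊆ O` (the maximal cosets inside `O`). [folklore] -/
theorem exists_disjoint_coset_cover [SecondCountableTopology G] (K : ℕ → Subgroup G) (hKo : ∀ n, IsOpen (K n : Set G)) (hanti : Antitone K)
    (hbasis : ∀ U ∈ 𝓝 (1 : G), ∃ n, (K n : Set G) ⊆ U) (O : Set G) (hO : IsOpen O) :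
    ∃ 𝒟 : Set (Set G), (∀ C ∈ 𝒟, ∃ (g : G) (n : ℕ), C = g • (K n : Set G)) ∧ 𝒟.Countable ∧ 𝒟.Pairwise Disjoint ∧ ⋃₀ 𝒟 = O := by
  classical
  -- every `x ∈ O` has a coset `x • K n ⊆ O`; take the least such `n`
  have hex : ∀ x ∈ O, ∃ n, x • (K n : Set G) ⊆ O := fun x hx => by
    have hc : Continuous fun y : G => x * y := continuous_const.mul continuous_id
    have h1 : (fun y => x * y) ⁻¹' O ∈ 𝓝 (1 : G) := hc.continuousAt.preimage_mem_nhds (by simpa using hO.mem_nhds hx)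
    obtain ⟨n, hn⟩ := hbasis _ h1
    refine ⟨n, ?_⟩
    rintro _ ⟨k, hk, rfl⟩
    exact hn hk
  let nx : ∀ x ∈ O, ℕ := fun x hx => Nat.find (hex x hx)
  have hnx : ∀ x (hx : x ∈ O), x • (K (nx x hx) : Set G) ⊆ O := fun x hx => Nat.find_spec (hex x hx)
  have hmin : ∀ x (hx : x ∈ O) m, x • (K m : Set G) ⊆ O → nx x hx ≤ m := fun x hx m hm => Nat.find_min' (hex x hx) hm
  set 𝒟 : Set (Set G) := {C | ∃ (x : G) (hx : x ∈ O), C = x • (K (nx x hx) : Set G)} with h𝒟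
  -- two maximal cosets meeting at a point coincide
  have hkey : ∀ x (hx : x ∈ O) y (hy : y ∈ O) z, z ∈ x • (K (nx x hx) : Set G) → z ∈ y • (K (nx y hy) : Set G) → nx x hx ≤ nx y hy →
      x • (K (nx x hx) : Set G) = y • (K (nx y hy) : Set G) := by
    intro x hx y hy z hzx hzy hle
    have hsub : (K (nx y hy) : Set G) ⊆ K (nx x hx) := hanti hle
    have hyx : y • (K (nx x hx) : Set G) = x • (K (nx x hx) : Set G) := by
      have hzin : z ∈ y • (K (nx x hx) : Set G) := smul_set_mono hsub hzy
      rw [← smul_coe_eq_of_mem (K (nx x hx)) hzin, smul_coe_eq_of_mem (K (nx x hx)) hzx]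
    have heq : nx y hy = nx x hx := le_antisymm (hmin y hy _ (hyx ▸ hnx x hx)) hle
    rw [heq, hyx]
  have hdisj : 𝒟.Pairwise Disjoint := by
    rintro C ⟨x, hx, rfl⟩ C' ⟨y, hy, rfl⟩ hne
    rw [Set.disjoint_iff]
    rintro z ⟨hzx, hzy⟩
    exfalso
    apply hne
    rcases le_total (nx x hx) (nx y hy) with hle | hle
    · exact hkey x hx y hy z hzx hzy hle
    · exact (hkey y hy x hx z hzy hzx hle).symm
  refine ⟨𝒟, ?_, ?_, hdisj, ?_⟩
  · rintro C ⟨x, hx, rfl⟩; exact ⟨x, nx x hx, rfl⟩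
  · -- pairwise disjoint nonempty open sets in a separable space
    have hdisj' : 𝒟.PairwiseDisjoint id := fun C hC C' hC' hne => by simpa only [Function.onFun, id] using hdisj hC hC' hne
    refine hdisj'.countable_of_isOpen (fun C hC => ?_) (fun C hC => ?_)
    · obtain ⟨x, hx, rfl⟩ := hC; exact (hKo _).smul x
    · obtain ⟨x, hx, rfl⟩ := hC; exact ⟨x, mem_own_smul_coe (K _) x⟩
  · apply le_antisymm
    · rintro z ⟨C, ⟨x, hx, rfl⟩, hz⟩; exact hnx x hx hz
    · intro x hx
      exact ⟨_, ⟨x, hx, rfl⟩, mem_own_smul_coe (K _) x⟩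

/-- **(J6b) PACKAGED: the coset family of the deep levels is a measurable, disjointly-covering family.**  For `𝒞 := {g • Kₙ | g ∈ G, n ≥ n₀}` (open subgroups `Kₙ`, antitone, a
neighbourhood basis of `1`; `G` second countable with a Borel-compatible σ-algebra): every member is measurable, and every open `O` is `⋃₀ 𝒟` for some countable pairwise disjoint `𝒟 ⊆ 𝒞`
— the `𝒞 ∕ 𝒟` clause of (J1)(b) `tubeJacobianLocal_of_cover`, with the levels restricted to `n ≥ n₀` (where the ORBIT-TUBE identity holds). [folklore] -/
theorem cosetFamily_measurable_and_cover [SecondCountableTopology G] [MeasurableSpace G] [OpensMeasurableSpace G]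
    (K : ℕ → Subgroup G) (hKo : ∀ n, IsOpen (K n : Set G)) (hanti : Antitone K) (hbasis : ∀ U ∈ 𝓝 (1 : G), ∃ n, (K n : Set G) ⊆ U) (n₀ : ℕ) :
    (∀ C ∈ {C : Set G | ∃ (g : G) (n : ℕ), n₀ ≤ n ∧ C = g • (K n : Set G)}, MeasurableSet C) ∧
      ∀ O : Set G, IsOpen O → ∃ 𝒟 : Set (Set G), 𝒟 ⊆ {C : Set G | ∃ (g : G) (n : ℕ), n₀ ≤ n ∧ C = g • (K n : Set G)} ∧
        𝒟.Countable ∧ 𝒟.Pairwise Disjoint ∧ ⋃₀ 𝒟 = O := by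
  refine ⟨?_, fun O hO => ?_⟩
  · rintro C ⟨g, n, -, rfl⟩
    exact ((hKo n).smul g).measurableSet
  · -- the shifted family `K (n₀ + m)` is again an antitone open basis
    have hanti' : Antitone fun m => K (n₀ + m) := fun a b hab => hanti (Nat.add_le_add_left hab n₀)
    have hbasis' : ∀ U ∈ 𝓝 (1 : G), ∃ m, (K (n₀ + m) : Set G) ⊆ U := fun U hU => by
      obtain ⟨n, hn⟩ := hbasis U hU
      exact ⟨n, fun x hx => hn (hanti (Nat.le_add_left n n₀) hx)⟩
    obtain ⟨𝒟, h𝒟, hc, hd, hU⟩ := exists_disjoint_coset_cover (fun m => K (n₀ + m)) (fun m => hKo _) hanti' hbasis' O hO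
    refine ⟨𝒟, fun C hC => ?_, hc, hd, hU⟩
    obtain ⟨g, m, rfl⟩ := h𝒟 C hC
    exact ⟨g, n₀ + m, Nat.le_add_right n₀ m, rfl⟩

end Summit.HodgeConjecture.HodgeConjecture.Cruxes.H413.F0P3cStCharTSOpenCosetCover
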